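import Literature.Probability.LatticeModels.DiscreteGreenKernelConvergenceProofs
import Literature.Probability.LatticeModels.MeshInteriorHoleFree
import Literature.Probability.LatticeModels.ExteriorLatticePath
import Literature.Probability.LatticeModels.MeshDomainJordan
import Literature.Probability.LatticeModels.KilledGreenMonotone
import HarnessLib

/-!
# Interior convergence of the Green's function of the edge-killed walk on the lattice
# approximation `Ω_δ` of a Jordan domain (Chelkak–Wan 2021, Cor. 3.3, by an inner/outer sandwich)

Topic `Literature/Probability/LatticeModels`; companion of `DiscreteGreenKernelConvergence.lean`
(the named fact: Chelkak–Wan 2021, Cor. 3.3 for SITE-killed walks on hole-free induced lattice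
domains) and `DiscreteGreenKernelConvergenceProofs.lean` (its proof, and the hole-free-only form
`killedGreen_tendsto_of_holeFree_of_kernelConvergence`). The tree discretises a planar domain `Ω`
at mesh `δ` by `Ω_δ = discreteDomainGraph Ω δ` — vertex set `meshDomain Ω δ` (largest mesh
component of `Ω ∩ δℤ²`), edges the lattice edges whose closed segment lies in `Ω̄` — and runs the
simple random walk along `Ω_δ`-edges, killing it at its first non-`Ω_δ` step (`SRW.killedGreen`,
`SRWKilledWalkFunctionals.lean`). This is NOT an induced subgraph of `ℤ²` (edges are deleted, and
`meshDomain` may enclose lattice lakes), a discretisation that [CW21]/[CS11] do not treat. This file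
proves the interior two-point convergence for it nevertheless, for JORDAN domains:

**Theorem** (`JordanDomain.killedGreen_discreteDomainGraph_tendsto`). *Let `D` be a Jordan domain,
`ψ : ℍ → D` conformal, `x ≠ y ∈ D`, and `x_δ, y_δ ∈ Ω_δ` lattice families with `δx_δ → x`,
`δy_δ → y`. Then `G_{Ω_δ}(x_δ, y_δ) → (2/π) log(‖ψ⁻¹x − conj ψ⁻¹y‖/‖ψ⁻¹x − ψ⁻¹y‖)` as `δ → 0⁺`.*

This is exactly the hypothesis `(GC)` of
`KozdronLawler2005_martinRatioBoundaryLimit_of_greenConvergence_of_uniformBHP`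
(`MartinRatioBoundaryLimit.lean`), with `c = 2/π`.

## Proof: the hole-free sandwich

* INNER — the free sites `A⁻_δ = Ω_δ ∖ ∂Ω_δ` (`meshInteriorFinset`): hole-free at every mesh
  (`JordanDomain.holeFree_meshInteriorFinset`, `MeshInteriorHoleFree.lean`); a free site is joined in
  `Ω_δ` to its four neighbours, so `siteGraph A⁻_δ ≤ Ω_δ` (`siteGraph_meshInteriorFinset_le`);
  compacts of `D` consist of free sites for small `δ` (`JordanDomain.eventually_forall_mem_meshInteriorFinset`,
  from `JordanDomain.eventually_forall_mem_meshDomain'`), whence kernel convergence of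
  `δ • starDomain A⁻_δ` to `D` (`JordanDomain.kernelConvergence_meshInteriorFinset`; the boundary
  clause: between an exterior site and a free site near `a ∈ ∂D` the segment crosses the frontier of
  the polygonal domain).
* OUTER — `A⁺_δ = (ExtConn D δ)ᶜ`, the complement of the exterior lattice component
  (`ExteriorLatticePath.lean`): hole-free (`holeFree_compl_extConn`), finite
  (`finite_compl_extConn`: far sites escape, `mem_extConn_of_norm_gt`), `Ω_δ ≤ siteGraph A⁺_δ`
  (vertices of `Ω_δ` have mesh points in `D`), and kernel convergent
  (`JordanDomain.kernelConvergence_compl_extConn`; the boundary clause uses the exterior sites near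
  `∂D` of `eventually_exists_extConn_near` — the one place where the Jordan curve theorem enters).
* SANDWICH — `SRW.killedGreen_mono` (`KilledGreenMonotone.lean`) and the hole-free Cor. 3.3 on both
  sides.

Everything is proved; no definition, no named fact. Deliberately NOT here: general simply connected
domains (the Jordan hypothesis feeds `meshDomain = bulk` and the exterior component); boundary
poles; uniformity.

## References

* D. Chelkak, Y. Wan, Electron. J. Probab. 26 (2021), paper no. 54, §3.1, Cor. 3.3 [ChelkakWan2021].
* D. Chelkak, S. Smirnov, Adv. Math. 228 (2011) 1590–1630, §3.2–§3.3 [ChelkakSmirnov2011].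
* S. Smirnov, Ann. of Math. 172 (2010), App. B (simply connected lattice domains) [Smirnov2010].
-/

noncomputable section

open Set Metric Filter Complex
open scoped Topology Real Pointwise
open Literature.Probability.RandomPlanarGeometry

namespace Literature.Probability.LatticeModels

/-! ### Segments, frontiers, stars -/

/-- A segment from a point of an open set to a point outside it meets the frontier. [folklore] -/
theorem exists_mem_segment_mem_frontier_of_isOpen {U : Set ℂ} (hU : IsOpen U) {q p : ℂ} (hq : q ∈ U) (hp : p ∉ U) :
    ∃ w ∈ segment ℝ q p, w ∈ frontier U := by
  by_contra hcon
  push Not at hcon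
  have hs : IsPreconnected (segment ℝ q p) := (convex_segment q p).isPreconnected
  have hsub : segment ℝ q p ⊆ U := by
    refine hs.subset_of_closure_inter_subset hU ⟨q, left_mem_segment ℝ q p, hq⟩ ?_
    rintro w ⟨hwcl, hws⟩
    by_contra hwU
    exact hcon w hws (by rw [hU.frontier_eq]; exact ⟨hwcl, hwU⟩)
  exact hp (hsub (right_mem_segment ℝ q p))

/-- If the site nearest to `w/δ` lies in `A`, then `w` lies in the polygonal representation
`δ • starDomain A`. [folklore] -/
theorem mem_smul_starDomain_of_nearestSite_mem {δ : ℝ} (hδ : 0 < δ) {A : Set (Site 2)} {w : ℂ}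
    (h : nearestSite δ w ∈ A) : w ∈ δ • ChelkakSmirnov.starDomain A := by
  by_contra hw
  exact nearestSite_not_mem_of_not_mem_smul_starDomain hδ hw h

/-- The polygonal representation of a set of sites whose mesh points lie in `closedBall 0 R₀` lies
in `ball 0 (R₀ + 3)` (mesh `δ ≤ 1`). [folklore] -/
theorem smul_starDomain_subset_ball {δ R₀ : ℝ} (hδ : 0 < δ) (hδ1 : δ ≤ 1) {A : Set (Site 2)}
    (hA : ∀ x ∈ A, ‖meshPoint δ x‖ ≤ R₀) : δ • ChelkakSmirnov.starDomain A ⊆ ball (0 : ℂ) (R₀ + 3) := by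
  intro w hw
  obtain ⟨x, hx, h0, h1⟩ := (mem_smul_starDomain_iff_div hδ).1 hw
  have hx' := hA x hx
  rw [mem_ball_zero_iff]
  have hre : |w.re - δ * ((x 0 : ℤ) : ℝ)| < δ := by
    have e : w.re - δ * ((x 0 : ℤ) : ℝ) = δ * (w.re / δ - ((x 0 : ℤ) : ℝ)) := by field_simp
    rw [e, abs_mul, abs_of_pos hδ]
    exact (mul_lt_iff_lt_one_right hδ).2 h0
  have him : |w.im - δ * ((x 1 : ℤ) : ℝ)| < δ := by
    have e : w.im - δ * ((x 1 : ℤ) : ℝ) = δ * (w.im / δ - ((x 1 : ℤ) : ℝ)) := by field_simp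
    rw [e, abs_mul, abs_of_pos hδ]
    exact (mul_lt_iff_lt_one_right hδ).2 h1
  have hdiff : ‖w - meshPoint δ x‖ < 2 * δ := by
    refine (norm_le_abs_re_add_abs_im _).trans_lt ?_
    rw [sub_re, sub_im, meshPoint_re, meshPoint_im]
    linarith
  have hsub := norm_sub_norm_le w (meshPoint δ x)
  linarith


/-! ### The inner approximation: the free sites `Ω_δ ∖ ∂Ω_δ` -/

section Inner

/-- The induced lattice graph on the free sites `Ω_δ ∖ ∂Ω_δ` is a subgraph of `Ω_δ` (a free site is
joined in `Ω_δ` to all four lattice neighbours). [folklore] -/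
theorem siteGraph_meshInteriorFinset_le (Ω : Set ℂ) (δ : ℝ) :
    ChordalLERW.siteGraph (↑(meshInteriorFinset Ω δ) : Set (Site 2)) ≤ discreteDomainGraph Ω δ := by
  intro x y h
  obtain ⟨hadj, hx, -⟩ := ChordalLERW.siteGraph_adj_iff.1 h
  exact MeshInteriorHoleFree.adj_of_mem (Finset.mem_coe.1 hx) hadj

variable (D : JordanDomain)

/-- **Compacts are eventually made of free sites**: for a compact `K ⊆ D`, for all small meshes
every site with mesh point in `K` is a free site of `Ω_δ ∖ ∂Ω_δ` (its neighbours and closed mesh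
edges lie in a compact neighbourhood of `K` inside `D`, whose sites are in `Ω_δ` by
`JordanDomain.eventually_forall_mem_meshDomain'`). [folklore] -/
theorem _root_.Literature.Probability.RandomPlanarGeometry.JordanDomain.eventually_forall_mem_meshInteriorFinset {K : Set ℂ} (hK : IsCompact K)
    (hKD : K ⊆ D.carrier) :
    ∀ᶠ δ in 𝓝[>] (0 : ℝ), ∀ x : Site 2, meshPoint δ x ∈ K → x ∈ meshInteriorFinset D.carrier δ := by
  obtain ⟨r, hr, hrD⟩ := hK.exists_cthickening_subset_open D.isOpen hKD
  have hK' : IsCompact (cthickening r K) := hK.cthickening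
  filter_upwards [D.eventually_forall_mem_meshDomain' hK' hrD, Ioo_mem_nhdsGT hr] with δ hδ hδr
  obtain ⟨hδ0, hδr⟩ := hδr
  intro x hx
  have hxD : x ∈ meshDomain D.carrier δ := hδ.1 x (self_subset_cthickening _ hx)
  rw [← Finset.mem_coe, coe_meshInteriorFinset D.isBounded hδ0]
  refine ⟨hxD, fun hxB => ?_⟩
  obtain ⟨-, y, hxy, hnadj⟩ := hxB
  apply hnadj
  obtain ⟨k, rfl⟩ := WeakBeurling.exists_eq_add_cornerUnit_of_adj hxy
  have hdist : dist (meshPoint δ (x + cornerUnit k)) (meshPoint δ x) = δ :=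
    dist_meshPoint_add_cornerUnit hδ0 x k
  have hyK : meshPoint δ (x + cornerUnit k) ∈ cthickening r K :=
    mem_cthickening_of_dist_le _ _ _ _ hx (by rw [hdist]; exact hδr.le)
  refine discreteDomainGraph_adj_iff.2 ⟨meshGraph_adj_iff.2 ⟨hxy, ?_⟩, hxD, hδ.1 _ hyK⟩
  intro w hw
  apply subset_closure
  apply hrD
  have hwx : dist w (meshPoint δ x) ≤ δ := by
    have hconv := (convex_closedBall (meshPoint δ x) δ).segment_subset (mem_closedBall_self hδ0.le)
      (mem_closedBall.2 hdist.le)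
    exact mem_closedBall.1 (hconv hw)
  exact mem_cthickening_of_dist_le _ _ _ _ hx (hwx.trans hδr.le)

/-- **Kernel convergence of the inner approximation**: the polygonal representations of the free
sites `Ω_δ ∖ ∂Ω_δ` of a Jordan domain `D` converge to `D` in the kernel (Carathéodory) sense of
[CS11] §3.2 — interior balls are eventually covered; near every boundary point the frontier of the
polygonal domain passes between an exterior site and a free site. [folklore] -/
theorem _root_.Literature.Probability.RandomPlanarGeometry.JordanDomain.kernelConvergence_meshInteriorFinset :
    ChelkakSmirnov.KernelConvergence
      (fun δ => δ • ChelkakSmirnov.starDomain (↑(meshInteriorFinset D.carrier δ) : Set (Site 2))) D.carrier := by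
  constructor
  · intro z hz
    obtain ⟨ρ, hρ, hρD⟩ := Metric.isOpen_iff.1 D.isOpen z hz
    have hcb : closedBall z (ρ / 2) ⊆ D.carrier := (closedBall_subset_ball (half_lt_self hρ)).trans hρD
    refine ⟨ρ / 4, by positivity, ?_⟩
    filter_upwards [D.eventually_forall_mem_meshInteriorFinset (isCompact_closedBall z (ρ / 2)) hcb,
      Ioo_mem_nhdsGT (show (0 : ℝ) < ρ / 4 by positivity)] with δ hδ hδI
    intro w hw
    apply mem_smul_starDomain_of_nearestSite_mem hδI.1
    refine Finset.mem_coe.2 (hδ _ (mem_closedBall.2 ?_))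
    have h1 := dist_meshPoint_nearestSite_le hδI.1 w
    have h2 : dist w z < ρ / 4 := mem_ball.1 hw
    have h3 : δ < ρ / 4 := hδI.2
    linarith [dist_triangle (meshPoint δ (nearestSite δ w)) w z]
  · intro a ha ρ hρ
    -- an exterior point `e` and an interior point `z` near `a`
    have hacl : a ∈ closure (closure D.carrier)ᶜ := D.frontier_subset_closure_exterior' ha
    obtain ⟨e, he, hae⟩ := Metric.mem_closure_iff.1 hacl (ρ / 2) (half_pos hρ)
    obtain ⟨re, hre, hreS⟩ := Metric.isOpen_iff.1 isClosed_closure.isOpen_compl e he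
    have hacl' : a ∈ closure D.carrier := frontier_subset_closure ha
    obtain ⟨z, hz, haz⟩ := Metric.mem_closure_iff.1 hacl' (ρ / 2) (half_pos hρ)
    obtain ⟨rz, hrz, hrzD⟩ := Metric.isOpen_iff.1 D.isOpen z hz
    have hcb : closedBall z (rz / 2) ⊆ D.carrier := (closedBall_subset_ball (half_lt_self hrz)).trans hrzD
    have hm : 0 < min (min re (rz / 2)) (ρ / 2 - max (dist a e) (dist a z)) := by
      refine lt_min (lt_min hre (half_pos hrz)) ?_
      have := max_lt hae haz
      linarith
    filter_upwards [D.eventually_forall_mem_meshInteriorFinset (isCompact_closedBall z (rz / 2)) hcb,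
      Ioo_mem_nhdsGT hm] with δ hδ hδI
    obtain ⟨hδ0, hδm⟩ := hδI
    have hδre : δ < re := (lt_min_iff.1 (lt_min_iff.1 hδm).1).1
    have hδrz : δ < rz / 2 := (lt_min_iff.1 (lt_min_iff.1 hδm).1).2
    have hδρ : δ < ρ / 2 - max (dist a e) (dist a z) := (lt_min_iff.1 hδm).2
    set U : Set ℂ := δ • ChelkakSmirnov.starDomain (↑(meshInteriorFinset D.carrier δ) : Set (Site 2)) with hU
    have hUo : IsOpen U := isOpen_smul_starDomain hδ0 _
    -- the exterior site
    set p : Site 2 := nearestSite δ e with hp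
    have hpe : dist (meshPoint δ p) e ≤ δ := dist_meshPoint_nearestSite_le hδ0 e
    have hpcl : meshPoint δ p ∉ closure D.carrier := hreS (mem_ball.2 (hpe.trans_lt hδre))
    have hpU : meshPoint δ p ∉ U := by
      intro h
      have h' := (meshPoint_mem_smul_starDomain_iff hδ0).1 h
      exact hpcl (subset_closure (MeshInteriorHoleFree.meshPoint_mem_of_mem (Finset.mem_coe.1 h')))
    -- the interior site
    set q : Site 2 := nearestSite δ z with hq
    have hqz : dist (meshPoint δ q) z ≤ δ := dist_meshPoint_nearestSite_le hδ0 z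
    have hqU : meshPoint δ q ∈ U :=
      (meshPoint_mem_smul_starDomain_iff hδ0).2 (Finset.mem_coe.2 (hδ q (mem_closedBall.2 (hqz.trans hδrz.le))))
    -- the frontier point on the segment
    obtain ⟨w, hw, hwfr⟩ := exists_mem_segment_mem_frontier_of_isOpen hUo hqU hpU
    refine ⟨w, hwfr, ?_⟩
    have hqa : meshPoint δ q ∈ ball a ρ := by
      rw [mem_ball]
      have := le_max_right (dist a e) (dist a z)
      rw [dist_comm] at haz
      linarith [dist_triangle (meshPoint δ q) z a, dist_comm z a]
    have hpa : meshPoint δ p ∈ ball a ρ := by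
      rw [mem_ball]
      have := le_max_left (dist a e) (dist a z)
      linarith [dist_triangle (meshPoint δ p) e a, dist_comm e a]
    exact (convex_ball a ρ).segment_subset hqa hpa hw

/-- The polygonal representations of the free sites stay in a fixed ball. [folklore] -/
theorem _root_.Literature.Probability.RandomPlanarGeometry.JordanDomain.eventually_smul_starDomain_meshInteriorFinset_subset {R₀ : ℝ}
    (hR₀ : D.carrier ⊆ closedBall (0 : ℂ) R₀) :
    ∀ᶠ δ in 𝓝[>] (0 : ℝ),
      δ • ChelkakSmirnov.starDomain (↑(meshInteriorFinset D.carrier δ) : Set (Site 2)) ⊆ ball (0 : ℂ) (R₀ + 3) := by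
  filter_upwards [Ioo_mem_nhdsGT one_pos] with δ hδ
  refine smul_starDomain_subset_ball hδ.1 hδ.2.le fun x hx => ?_
  exact mem_closedBall_zero_iff.1 (hR₀ (MeshInteriorHoleFree.meshPoint_mem_of_mem (Finset.mem_coe.1 hx)))

end Inner


/-! ### The outer approximation: the complement of the exterior lattice component -/

section Outer

/-- Mesh points: `‖δ z‖² = (δ z₀)² + (δ z₁)²`. [folklore] -/
theorem norm_meshPoint_sq_coord (δ : ℝ) (z : Site 2) :
    ‖meshPoint δ z‖ ^ 2 = (δ * ((z 0 : ℤ) : ℝ)) ^ 2 + (δ * ((z 1 : ℤ) : ℝ)) ^ 2 := by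
  rw [Complex.sq_norm, Complex.normSq_apply, meshPoint_re, meshPoint_im]; ring

/-- `|δ z₀| ≤ ‖δ z‖`. [folklore] -/
theorem abs_mul_coord_le_norm_meshPoint (δ : ℝ) (z : Site 2) :
    |δ * ((z 0 : ℤ) : ℝ)| ≤ ‖meshPoint δ z‖ := by
  have := abs_re_le_norm (meshPoint δ z)
  rwa [meshPoint_re] at this

/-- **Far sites are in the exterior component**: if `closure Ω ⊆ closedBall 0 R₀` and the mesh
point of `y` has norm `> R₀`, then `y ∈ ExtConn Ω δ` (go horizontally away from the axis, then
straight up: all these mesh points have norm `> R₀`). [folklore] -/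
theorem mem_extConn_of_norm_gt {Ω : Set ℂ} {R₀ δ : ℝ} (hcl : closure Ω ⊆ closedBall (0 : ℂ) R₀)
    (hδ : 0 < δ) {y : Site 2} (hy : R₀ < ‖meshPoint δ y‖) : y ∈ ExtConn Ω δ := by
  have hout : ∀ z : Site 2, R₀ < ‖meshPoint δ z‖ → meshPoint δ z ∉ closure Ω := fun z hz h => by
    have := mem_closedBall_zero_iff.1 (hcl h); linarith
  have hR₀ : R₀ < ‖meshPoint δ y‖ := hy
  refine ⟨hout y hy, fun M => ?_⟩
  -- horizontal leg
  set t₁ : ℕ := ⌊|R₀| / δ⌋₊ + 1 with ht₁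
  have ht₁R : |R₀| < δ * t₁ := by
    have := Nat.lt_floor_add_one (|R₀| / δ)
    rw [div_lt_iff₀ hδ] at this
    push_cast [ht₁]
    linarith
  -- the direction away from the vertical axis
  obtain ⟨k, hk0, hk1, hfar⟩ : ∃ k : Fin 4, (∀ s : ℕ, |((y 0 : ℤ) : ℝ)| ≤ |(((y + (s : ℤ) • cornerUnit k) 0 : ℤ) : ℝ)|) ∧
      (∀ s : ℕ, (y + (s : ℤ) • cornerUnit k) 1 = y 1) ∧
      (t₁ : ℝ) ≤ |(((y + (t₁ : ℤ) • cornerUnit k) 0 : ℤ) : ℝ)| := by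
    by_cases h0 : 0 ≤ y 0
    · refine ⟨0, fun s => ?_, fun s => by simp, ?_⟩
      · have : (y + (s : ℤ) • cornerUnit 0) 0 = y 0 + s := by simp
        rw [this]; push_cast
        rw [abs_of_nonneg (by exact_mod_cast h0), abs_of_nonneg (by positivity)]
        linarith
      · have : (y + (t₁ : ℤ) • cornerUnit 0) 0 = y 0 + t₁ := by simp
        rw [this]; push_cast
        rw [abs_of_nonneg (by positivity)]
        have : (0 : ℝ) ≤ y 0 := by exact_mod_cast h0
        linarith
    · push Not at h0
      refine ⟨2, fun s => ?_, fun s => by simp, ?_⟩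
      · have : (y + (s : ℤ) • cornerUnit 2) 0 = y 0 - s := by simp [sub_eq_add_neg]
        rw [this]; push_cast
        have h0' : ((y 0 : ℤ) : ℝ) < 0 := by exact_mod_cast h0
        have hs : (0 : ℝ) ≤ s := by positivity
        rw [abs_of_neg h0', abs_of_neg (by linarith)]
        linarith
      · have : (y + (t₁ : ℤ) • cornerUnit 2) 0 = y 0 - t₁ := by simp [sub_eq_add_neg]
        rw [this]; push_cast
        have h0' : ((y 0 : ℤ) : ℝ) < 0 := by exact_mod_cast h0
        have ht : (0 : ℝ) ≤ t₁ := by positivity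
        rw [abs_of_neg (by linarith)]
        linarith
  have hnorm : ∀ s : ℕ, ‖meshPoint δ y‖ ≤ ‖meshPoint δ (y + (s : ℤ) • cornerUnit k)‖ := by
    intro s
    refine (pow_le_pow_iff_left₀ (norm_nonneg _) (norm_nonneg _) two_ne_zero).1 ?_
    rw [norm_meshPoint_sq_coord, norm_meshPoint_sq_coord, hk1 s]
    have h1 := hk0 s
    have h2 : (δ * ((y 0 : ℤ) : ℝ)) ^ 2 ≤ (δ * (((y + (s : ℤ) • cornerUnit k) 0 : ℤ) : ℝ)) ^ 2 := by
      rw [mul_pow, mul_pow]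
      exact mul_le_mul_of_nonneg_left (sq_le_sq.2 h1) (sq_nonneg _)
    linarith
  set x' : Site 2 := y + (t₁ : ℤ) • cornerUnit k with hx'
  have leg1 : Relation.ReflTransGen (ExtStep Ω δ) y x' :=
    reflTransGen_extStep_line y k t₁ fun s _ => hout _ (hR₀.trans_le (hnorm s))
  -- vertical leg
  have hx'0 : R₀ < δ * |((x' 0 : ℤ) : ℝ)| := by
    calc R₀ ≤ |R₀| := le_abs_self _
      _ < δ * t₁ := ht₁R
      _ ≤ δ * |((x' 0 : ℤ) : ℝ)| := mul_le_mul_of_nonneg_left hfar hδ.le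
  set t₂ : ℕ := (M - x' 1).toNat with ht₂
  have leg2 : Relation.ReflTransGen (ExtStep Ω δ) x' (x' + (t₂ : ℤ) • cornerUnit 1) := by
    refine reflTransGen_extStep_line x' 1 t₂ fun s _ => hout _ ?_
    have h0 : (x' + (s : ℤ) • cornerUnit 1) 0 = x' 0 := by simp
    calc R₀ < δ * |((x' 0 : ℤ) : ℝ)| := hx'0
      _ = |δ * (((x' + (s : ℤ) • cornerUnit 1) 0 : ℤ) : ℝ)| := by rw [h0, abs_mul, abs_of_pos hδ]
      _ ≤ _ := abs_mul_coord_le_norm_meshPoint δ _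
  refine ⟨x' + (t₂ : ℤ) • cornerUnit 1, ?_, leg1.trans leg2⟩
  have h1 : (x' + (t₂ : ℤ) • cornerUnit 1) 1 = x' 1 + t₂ := by simp
  rw [h1, ht₂]
  omega

/-- The complement of the exterior component is finite (its mesh points lie in a ball).
[folklore] -/
theorem finite_compl_extConn {Ω : Set ℂ} (hΩ : Bornology.IsBounded Ω) {δ : ℝ} (hδ : 0 < δ) :
    ((ExtConn Ω δ)ᶜ).Finite := by
  obtain ⟨R₀, hR₀⟩ := (Metric.isBounded_iff_subset_closedBall (0 : ℂ)).1 hΩ.closure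
  refine (meshVertices_finite (Metric.isBounded_closedBall (x := (0 : ℂ)) (r := R₀)) hδ).subset fun y hy => ?_
  rw [mem_meshVertices_iff, mem_closedBall_zero_iff]
  by_contra h
  exact hy (mem_extConn_of_norm_gt hR₀ hδ (lt_of_not_ge h))

/-- Mesh points of sites outside the exterior component lie in the bounding ball. [folklore] -/
theorem norm_meshPoint_le_of_not_mem_extConn {Ω : Set ℂ} {R₀ δ : ℝ}
    (hcl : closure Ω ⊆ closedBall (0 : ℂ) R₀) (hδ : 0 < δ) {y : Site 2} (hy : y ∉ ExtConn Ω δ) :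
    ‖meshPoint δ y‖ ≤ R₀ := by
  by_contra h
  exact hy (mem_extConn_of_norm_gt hcl hδ (lt_of_not_ge h))

/-- `Ω_δ` is a subgraph of the induced lattice graph on the complement of the exterior component
(the vertices of `Ω_δ` have mesh points in `Ω`). [folklore] -/
theorem discreteDomainGraph_le_siteGraph_compl_extConn (Ω : Set ℂ) (δ : ℝ) :
    discreteDomainGraph Ω δ ≤ ChordalLERW.siteGraph (ExtConn Ω δ)ᶜ := by
  intro x y h
  obtain ⟨hmesh, hx, hy⟩ := discreteDomainGraph_adj_iff.1 h
  exact ChordalLERW.siteGraph_adj_iff.2 ⟨(meshGraph_adj_iff.1 hmesh).1,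
    not_mem_extConn_of_mem (meshDomain_subset_meshVertices _ _ hx),
    not_mem_extConn_of_mem (meshDomain_subset_meshVertices _ _ hy)⟩

variable (D : JordanDomain)

/-- **Kernel convergence of the outer approximation**: for a Jordan domain `D` and finite sets
`A⁺_δ` of sites with `A⁺_δ = (ExtConn D δ)ᶜ` for `δ > 0`, the polygonal representations
`δ • starDomain A⁺_δ` converge to `D` in the kernel sense — interior balls are covered at once
(sites with mesh point in `D` are not exterior); near a boundary point the frontier of the polygonal
domain passes between a site of the exterior component (`eventually_exists_extConn_near`, the
Jordan curve theorem) and an interior site. [folklore] -/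
theorem _root_.Literature.Probability.RandomPlanarGeometry.JordanDomain.kernelConvergence_compl_extConn
    (Ap : ℝ → Finset (Site 2)) (hAp : ∀ δ : ℝ, 0 < δ → (↑(Ap δ) : Set (Site 2)) = (ExtConn D.carrier δ)ᶜ) :
    ChelkakSmirnov.KernelConvergence
      (fun δ => δ • ChelkakSmirnov.starDomain (↑(Ap δ) : Set (Site 2))) D.carrier := by
  constructor
  · intro z hz
    obtain ⟨ρ, hρ, hρD⟩ := Metric.isOpen_iff.1 D.isOpen z hz
    refine ⟨ρ / 2, by positivity, ?_⟩
    filter_upwards [Ioo_mem_nhdsGT (show (0 : ℝ) < ρ / 2 by positivity)] with δ hδI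
    intro w hw
    apply mem_smul_starDomain_of_nearestSite_mem hδI.1
    rw [hAp δ hδI.1, mem_compl_iff]
    refine not_mem_extConn_of_mem (hρD (mem_ball.2 ?_))
    have h1 := dist_meshPoint_nearestSite_le hδI.1 w
    have h2 : dist w z < ρ / 2 := mem_ball.1 hw
    have h3 : δ < ρ / 2 := hδI.2
    linarith [dist_triangle (meshPoint δ (nearestSite δ w)) w z]
  · intro a ha ρ hρ
    have hacl' : a ∈ closure D.carrier := frontier_subset_closure ha
    obtain ⟨z, hz, haz⟩ := Metric.mem_closure_iff.1 hacl' (ρ / 2) (half_pos hρ)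
    obtain ⟨rz, hrz, hrzD⟩ := Metric.isOpen_iff.1 D.isOpen z hz
    have hm : 0 < min rz (ρ / 2 - dist a z) := lt_min hrz (by linarith)
    filter_upwards [eventually_exists_extConn_near D ha (half_pos hρ), Ioo_mem_nhdsGT hm] with δ hδ hδI
    obtain ⟨hδ0, hδm⟩ := hδI
    have hδrz : δ < rz := (lt_min_iff.1 hδm).1
    have hδρ : δ < ρ / 2 - dist a z := (lt_min_iff.1 hδm).2
    obtain ⟨p, hpa, hpE⟩ := hδ
    set U : Set ℂ := δ • ChelkakSmirnov.starDomain (↑(Ap δ) : Set (Site 2)) with hU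
    have hUo : IsOpen U := isOpen_smul_starDomain hδ0 _
    have hpU : meshPoint δ p ∉ U := by
      intro h
      have h' := (meshPoint_mem_smul_starDomain_iff hδ0).1 h
      rw [hAp δ hδ0] at h'
      exact h' hpE
    set q : Site 2 := nearestSite δ z with hq
    have hqz : dist (meshPoint δ q) z ≤ δ := dist_meshPoint_nearestSite_le hδ0 z
    have hqU : meshPoint δ q ∈ U := by
      refine (meshPoint_mem_smul_starDomain_iff hδ0).2 ?_
      rw [hAp δ hδ0, mem_compl_iff]
      exact not_mem_extConn_of_mem (hrzD (mem_ball.2 (hqz.trans_lt hδrz)))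
    obtain ⟨w, hw, hwfr⟩ := exists_mem_segment_mem_frontier_of_isOpen hUo hqU hpU
    refine ⟨w, hwfr, ?_⟩
    have hqa : meshPoint δ q ∈ ball a ρ := by
      rw [mem_ball]
      linarith [dist_triangle (meshPoint δ q) z a, dist_comm z a]
    have hpa' : meshPoint δ p ∈ ball a ρ := mem_ball.2 (hpa.trans (half_lt_self hρ))
    exact (convex_ball a ρ).segment_subset hqa hpa' hw

end Outer


/-! ### The theorem: interior convergence of the Green's function of `Ω_δ` -/

section Main

open UpperHalfPlane (upperHalfPlaneSet)

variable (D : JordanDomain)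

/-- **Interior convergence of the Green's function of the edge-killed walk on `Ω_δ`** (the
analogue, for the tree's discretisation `discreteDomainGraph` of a Jordan domain — largest mesh
component, closed mesh edges inside `Ω̄`, the walk killed at its first non-`Ω_δ` step — of
Chelkak–Wan 2021, Cor. 3.3): for `x ≠ y` in `D` and lattice families `x_δ → x`, `y_δ → y` in
`Ω_δ`, `G_{Ω_δ}(x_δ, y_δ) → (2/π) G_ℍ(ψ⁻¹x, ψ⁻¹y)`, `G_ℍ(w, z) = log(‖w − z̄‖/‖w − z‖)`.
Proof: the INNER/OUTER HOLE-FREE SANDWICH. The free sites `Ω_δ ∖ ∂Ω_δ` are hole-free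
(`JordanDomain.holeFree_meshInteriorFinset`) and their induced graph is a subgraph of `Ω_δ`, which in
turn is a subgraph of the induced graph on the (hole-free, `holeFree_compl_extConn`) complement of
the exterior lattice component; the killed Green's function is monotone in the graph
(`SRW.killedGreen_mono`); both bounds converge to the same limit by the hole-free form of Cor. 3.3
(`killedGreen_tendsto_of_holeFree_of_kernelConvergence`), their polygonal representations
converging to `D` in the kernel sense (`JordanDomain.kernelConvergence_meshInteriorFinset`,
`JordanDomain.kernelConvergence_compl_extConn`). This is the statement `(GC)` taken as a
hypothesis by `KozdronLawler2005_martinRatioBoundaryLimit_of_greenConvergence_of_uniformBHP`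
(`MartinRatioBoundaryLimit.lean`), with `c = 2/π`.
[cite: ChelkakWan2021, Corollary 3.3 (§3.1)] -/
theorem _root_.Literature.Probability.RandomPlanarGeometry.JordanDomain.killedGreen_discreteDomainGraph_tendsto
    (ψ : ConformalEquiv upperHalfPlaneSet D.carrier) :
    ∃ c : ℝ, 0 < c ∧ ∀ x ∈ D.carrier, ∀ y ∈ D.carrier, x ≠ y → ∀ xs ys : ℝ → Site 2,
      Tendsto (fun δ => meshPoint δ (xs δ)) (𝓝[>] 0) (𝓝 x) →
      Tendsto (fun δ => meshPoint δ (ys δ)) (𝓝[>] 0) (𝓝 y) →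
      (∀ᶠ δ in 𝓝[>] 0, xs δ ∈ meshDomain D.carrier δ ∧ ys δ ∈ meshDomain D.carrier δ) →
      Tendsto (fun δ => SRW.killedGreen (discreteDomainGraph D.carrier δ) (xs δ) (ys δ)) (𝓝[>] 0)
        (𝓝 (c * Real.log (‖ψ.symm x - (starRingEnd ℂ) (ψ.symm y)‖ / ‖ψ.symm x - ψ.symm y‖))) := by
  refine ⟨2 / Real.pi, by positivity, ?_⟩
  intro x hx y hy hxy xs ys hxs hys hmem
  classical
  -- a bounding ball
  obtain ⟨R₀, hR₀⟩ := (Metric.isBounded_iff_subset_closedBall (0 : ℂ)).1 D.isBounded.closure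
  have hDR₀ : D.carrier ⊆ closedBall (0 : ℂ) R₀ := subset_closure.trans hR₀
  set R : ℝ := R₀ + 3 with hR
  have hΩR : D.carrier ⊆ ball (0 : ℂ) R := fun z hz => by
    have := mem_closedBall_zero_iff.1 (hDR₀ hz)
    rw [mem_ball_zero_iff]; linarith
  -- the two approximations
  set Am : ℝ → Finset (Site 2) := fun δ => meshInteriorFinset D.carrier δ with hAm
  set Ap : ℝ → Finset (Site 2) := fun δ =>
    if h : 0 < δ then (finite_compl_extConn D.isBounded h).toFinset else ∅ with hAp
  have hApc : ∀ δ : ℝ, 0 < δ → (↑(Ap δ) : Set (Site 2)) = (ExtConn D.carrier δ)ᶜ := by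
    intro δ hδ
    simp only [hAp, dif_pos hδ, Set.Finite.coe_toFinset]
  -- eventual memberships of the families
  obtain ⟨rx, hrx, hrxD⟩ := Metric.isOpen_iff.1 D.isOpen x hx
  obtain ⟨ry, hry, hryD⟩ := Metric.isOpen_iff.1 D.isOpen y hy
  have hcbx : closedBall x (rx / 2) ⊆ D.carrier := (closedBall_subset_ball (half_lt_self hrx)).trans hrxD
  have hcby : closedBall y (ry / 2) ⊆ D.carrier := (closedBall_subset_ball (half_lt_self hry)).trans hryD
  have hmemM : ∀ᶠ δ in 𝓝[>] (0 : ℝ), xs δ ∈ Am δ ∧ ys δ ∈ Am δ := by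
    filter_upwards [D.eventually_forall_mem_meshInteriorFinset (isCompact_closedBall x (rx / 2)) hcbx,
      D.eventually_forall_mem_meshInteriorFinset (isCompact_closedBall y (ry / 2)) hcby,
      hxs (closedBall_mem_nhds x (half_pos hrx)), hys (closedBall_mem_nhds y (half_pos hry))]
      with δ h1 h2 h3 h4
    exact ⟨h1 _ h3, h2 _ h4⟩
  have hmemP : ∀ᶠ δ in 𝓝[>] (0 : ℝ), xs δ ∈ Ap δ ∧ ys δ ∈ Ap δ := by
    filter_upwards [hmem, self_mem_nhdsWithin] with δ hδ hδ0
    have hδ0' : 0 < δ := hδ0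
    constructor
    · rw [← Finset.mem_coe, hApc δ hδ0', mem_compl_iff]
      exact not_mem_extConn_of_mem (meshDomain_subset_meshVertices _ _ hδ.1)
    · rw [← Finset.mem_coe, hApc δ hδ0', mem_compl_iff]
      exact not_mem_extConn_of_mem (meshDomain_subset_meshVertices _ _ hδ.2)
  -- the inner limit
  have hinner : Tendsto (fun δ => SRW.killedGreen (ChordalLERW.siteGraph (↑(Am δ) : Set (Site 2))) (xs δ) (ys δ))
      (𝓝[>] 0) (𝓝 (2 / Real.pi * Real.log (‖ψ.symm x - (starRingEnd ℂ) (ψ.symm y)‖ / ‖ψ.symm x - ψ.symm y‖))) := by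
    refine killedGreen_tendsto_of_holeFree_of_kernelConvergence D.carrier R D.isOpen hΩR ψ Am ?_
      D.kernelConvergence_meshInteriorFinset x y hx hy hxy xs ys hmemM hxs hys
    filter_upwards [D.eventually_smul_starDomain_meshInteriorFinset_subset hDR₀] with δ hδ
    exact ⟨D.holeFree_meshInteriorFinset δ, hδ⟩
  -- the outer limit
  have houter : Tendsto (fun δ => SRW.killedGreen (ChordalLERW.siteGraph (↑(Ap δ) : Set (Site 2))) (xs δ) (ys δ))
      (𝓝[>] 0) (𝓝 (2 / Real.pi * Real.log (‖ψ.symm x - (starRingEnd ℂ) (ψ.symm y)‖ / ‖ψ.symm x - ψ.symm y‖))) := by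
    refine killedGreen_tendsto_of_holeFree_of_kernelConvergence D.carrier R D.isOpen hΩR ψ Ap ?_
      (D.kernelConvergence_compl_extConn Ap hApc) x y hx hy hxy xs ys hmemP hxs hys
    filter_upwards [Ioo_mem_nhdsGT one_pos] with δ hδ
    rw [hApc δ hδ.1]
    refine ⟨holeFree_compl_extConn D.carrier δ, smul_starDomain_subset_ball hδ.1 hδ.2.le fun z hz => ?_⟩
    exact norm_meshPoint_le_of_not_mem_extConn hR₀ hδ.1 hz
  -- the sandwich
  refine tendsto_of_tendsto_of_tendsto_of_le_of_le' hinner houter ?_ ?_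
  · filter_upwards [self_mem_nhdsWithin] with δ hδ
    exact SRW.killedGreen_mono (siteGraph_meshInteriorFinset_le D.carrier δ)
      (SRW.finite_support_discreteDomainGraph D.isBounded hδ) _ _
  · filter_upwards [self_mem_nhdsWithin] with δ hδ
    have hδ' : 0 < δ := hδ
    have hle : discreteDomainGraph D.carrier δ ≤ ChordalLERW.siteGraph (↑(Ap δ) : Set (Site 2)) := by
      rw [hApc δ hδ']
      exact discreteDomainGraph_le_siteGraph_compl_extConn D.carrier δ
    exact SRW.killedGreen_mono hle (KozdronLawler.finite_support_siteGraph (Ap δ)) _ _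

end Main

end Literature.Probability.LatticeModels
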